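import Mathlib
import Summits.Ventures.PercRepro.TriangleCapBipartiteThree
import Summits.Ventures.PercRepro.TriangleCapTriangleFreeTwoA

/-!
# PercRepro — THREE BELOW THE DIAGONAL ON TRIANGLE-FREE GRAPHS, PART A: the finer counts of the `X = N(v)`,
`Y = N(u)`, `Z` split (p3, gen 36; part 40)

On top of TriangleCapTriangleFreeTwoA (the per-`z` counts `far_pairs_lower`, `edges_at_Z_lower`, `per_z_arith`,
`xy_pair_lower`, the bipartiteness of `Z = ∅` / `Z = {z}` with all `X`–`Y` pairs adjacent), the counts the gap
`3 (k − 4)` needs: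

* `xy_star_lower` — the star bound of §10aw inside `X × Y`: `N₁ (|X| + |Y| − 1 − N₁) ≤ Σ_{A₁} (|X ∖ N(y)| + |Y ∖ N(x)|)`
  for `N₁` missing `X`–`Y` pairs, and `two_mul_missing_le` — `2 N₁ ≤` the same sum;
* `far_pairs_product_lower` — the far pairs of `z ∈ Z` inside `A₁` number at least `|X ∖ N(z)|·|Y ∖ N(z)| − N₁`;
* `mul_nbrs_le_missing` — `|N(z) ∩ X|·|N(z) ∩ Y| ≤ N₁` (a neighbour on each side is a non-adjacent pair);
* `card_le_deficit_of_no_nbr` — an edge inside `Z` whose ends have no neighbour in `Y` has all of `Y` in its deficit;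
* `sum_deficit_split_five` — `2 Σ_{A₁} + 2 Σ_{A₃} + Σ_{A₅} ≤ Σ deficit` with `A₅` the adjacent pairs inside `Z`;
* `bipartite_of_Z_singleton_noX` / `_noY` — `Z = {z}` with `z` having no neighbour in `X` (resp. `Y`) is bipartite;
* `bipartite_of_Z_pair` — `Z = {z₁, z₂}` with all `X`–`Y` pairs adjacent: unless `z₁ ~ z₂` with neighbours of both
  on the same side, the graph is bipartite spanning.
Axioms: standard.
-/

namespace PercRepro

namespace TriangleCap

namespace C047

open Finset

variable {V : Type*} [Fintype V] [DecidableEq V]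

omit [Fintype V] [DecidableEq V] in
/-- `A₁ = {(x, y) ∈ X × Y : x ~ y}` as a filtered product. -/
theorem A₁_eq_filter_product (D : SimpleGraph V) [DecidableRel D.Adj] {u v : V}
    (X Y : Finset V) (memX : ∀ w, w ∈ X ↔ D.Adj v w) (memY : ∀ w, w ∈ Y ↔ D.Adj u w)
    (A₁ : Finset (V × V)) (memA₁ : ∀ p, p ∈ A₁ ↔ D.Adj p.1 p.2 ∧ D.Adj v p.1 ∧ D.Adj u p.2) :
    A₁ = (X ×ˢ Y).filter (fun p => D.Adj p.1 p.2) := by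
  ext p
  rw [memA₁, mem_filter, mem_product, memX, memY]
  tauto

omit [Fintype V] in
/-- **THE STAR BOUND INSIDE `X × Y`:** with `N₁` missing `X`–`Y` pairs,
`N₁ (|X| + |Y| − 1 − N₁) ≤ Σ_{A₁} |X ∖ N(y)| + Σ_{A₁} |Y ∖ N(x)|`. -/
theorem xy_star_lower (D : SimpleGraph V) [DecidableRel D.Adj] {u v : V}
    (X Y : Finset V) (memX : ∀ w, w ∈ X ↔ D.Adj v w) (memY : ∀ w, w ∈ Y ↔ D.Adj u w)
    (A₁ : Finset (V × V)) (memA₁ : ∀ p, p ∈ A₁ ↔ D.Adj p.1 p.2 ∧ D.Adj v p.1 ∧ D.Adj u p.2) :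
    (missing D X Y).card * (X.card + Y.card - 1 - (missing D X Y).card) ≤
      ∑ p ∈ A₁, (X.filter (fun w => ¬ D.Adj p.2 w)).card + ∑ p ∈ A₁, (Y.filter (fun w => ¬ D.Adj p.1 w)).card := by
  rw [A₁_eq_filter_product D X Y memX memY A₁ memA₁]
  have e1 : ∑ p ∈ (X ×ˢ Y).filter (fun p => D.Adj p.1 p.2), (X.filter (fun w => ¬ D.Adj p.2 w)).card =
      ∑ y ∈ Y, (X.filter (fun w => ¬ D.Adj y w)).card * (X.filter (fun x => D.Adj x y)).card :=
    sum_adj_product_snd D X Y (fun y => (X.filter (fun w => ¬ D.Adj y w)).card)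
  have e2 : ∑ p ∈ (X ×ˢ Y).filter (fun p => D.Adj p.1 p.2), (Y.filter (fun w => ¬ D.Adj p.1 w)).card =
      ∑ x ∈ X, (Y.filter (fun w => ¬ D.Adj x w)).card * (Y.filter (fun y => D.Adj x y)).card :=
    sum_adj_product_fst D X Y (fun x => (Y.filter (fun w => ¬ D.Adj x w)).card)
  rw [e1, e2]
  -- the missing pairs at `y` towards `X`, in the orientation of `missing D X Y`
  have f1 : ∀ y ∈ Y, (X.filter (fun w => ¬ D.Adj y w)).card * (X.filter (fun x => D.Adj x y)).card +
      (X.filter (fun x => ¬ D.Adj x y)).card * (X.filter (fun x => ¬ D.Adj x y)).card =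
      (X.filter (fun x => ¬ D.Adj x y)).card * X.card := by
    intro y _
    have e : X.filter (fun w => ¬ D.Adj y w) = X.filter (fun x => ¬ D.Adj x y) := by
      apply filter_congr
      intro x _
      exact ⟨fun h h' => h h'.symm, fun h h' => h h'.symm⟩
    rw [e, ← Nat.mul_add, card_filter_add_card_filter_not (s := X) (fun x => D.Adj x y)]
  have f2 : ∀ x ∈ X, (Y.filter (fun w => ¬ D.Adj x w)).card * (Y.filter (fun y => D.Adj x y)).card +
      miss D Y x * miss D Y x = miss D Y x * Y.card := by
    intro x _
    unfold miss
    rw [← Nat.mul_add, card_filter_add_card_filter_not (s := Y) (fun y => D.Adj x y)]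
  have s1 := sum_congr rfl f1
  have s2 := sum_congr rfl f2
  rw [sum_add_distrib, ← sum_mul, ← card_missing_right] at s1
  rw [sum_add_distrib, ← sum_mul, ← card_missing_left] at s2
  have hsq := sum_sq_missing_le D X Y
  set N := (missing D X Y).card with hN
  by_cases hk : X.card + Y.card ≤ N + 1
  · have : X.card + Y.card - 1 - N = 0 := by omega
    rw [this]
    simp
  · obtain ⟨j, hj⟩ : ∃ j, X.card + Y.card = N + 1 + j := ⟨X.card + Y.card - N - 1, by omega⟩
    have e : X.card + Y.card - 1 - N = j := by omega
    rw [e]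
    have hXY : N * X.card + N * Y.card = N * (N + 1 + j) := by rw [← Nat.mul_add, hj]
    nlinarith [s1, s2, hsq, hXY]

omit [Fintype V] [DecidableEq V] in
/-- Every missing `X`–`Y` pair pays at least `2` inside `A₁` (`v` is a `Y`-neighbour of every `x`, `u` an
`X`-neighbour of every `y`). -/
theorem two_mul_missing_le (D : SimpleGraph V) [DecidableRel D.Adj] {u v : V} (huv : D.Adj u v)
    (X Y : Finset V) (memX : ∀ w, w ∈ X ↔ D.Adj v w) (memY : ∀ w, w ∈ Y ↔ D.Adj u w)
    (A₁ : Finset (V × V)) (memA₁ : ∀ p, p ∈ A₁ ↔ D.Adj p.1 p.2 ∧ D.Adj v p.1 ∧ D.Adj u p.2) :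
    2 * (missing D X Y).card ≤
      ∑ p ∈ A₁, (X.filter (fun w => ¬ D.Adj p.2 w)).card + ∑ p ∈ A₁, (Y.filter (fun w => ¬ D.Adj p.1 w)).card := by
  rw [A₁_eq_filter_product D X Y memX memY A₁ memA₁]
  have e1 : ∑ p ∈ (X ×ˢ Y).filter (fun p => D.Adj p.1 p.2), (X.filter (fun w => ¬ D.Adj p.2 w)).card =
      ∑ y ∈ Y, (X.filter (fun w => ¬ D.Adj y w)).card * (X.filter (fun x => D.Adj x y)).card :=
    sum_adj_product_snd D X Y (fun y => (X.filter (fun w => ¬ D.Adj y w)).card)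
  have e2 : ∑ p ∈ (X ×ˢ Y).filter (fun p => D.Adj p.1 p.2), (Y.filter (fun w => ¬ D.Adj p.1 w)).card =
      ∑ x ∈ X, (Y.filter (fun w => ¬ D.Adj x w)).card * (Y.filter (fun y => D.Adj x y)).card :=
    sum_adj_product_fst D X Y (fun x => (Y.filter (fun w => ¬ D.Adj x w)).card)
  rw [e1, e2]
  have huX : u ∈ X := (memX u).mpr huv.symm
  have hvY : v ∈ Y := (memY v).mpr huv
  have h1 : ∀ y ∈ Y, (X.filter (fun x => ¬ D.Adj x y)).card ≤
      (X.filter (fun w => ¬ D.Adj y w)).card * (X.filter (fun x => D.Adj x y)).card := by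
    intro y hy
    have e : X.filter (fun w => ¬ D.Adj y w) = X.filter (fun x => ¬ D.Adj x y) := by
      apply filter_congr
      intro x _
      exact ⟨fun h h' => h h'.symm, fun h h' => h h'.symm⟩
    rw [e]
    apply Nat.le_mul_of_pos_right
    exact card_pos.mpr ⟨u, mem_filter.mpr ⟨huX, (memY y).mp hy⟩⟩
  have h2 : ∀ x ∈ X, miss D Y x ≤ (Y.filter (fun w => ¬ D.Adj x w)).card * (Y.filter (fun y => D.Adj x y)).card := by
    intro x hx
    unfold miss
    apply Nat.le_mul_of_pos_right
    exact card_pos.mpr ⟨v, mem_filter.mpr ⟨hvY, ((memX x).mp hx).symm⟩⟩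
  have s1 := sum_le_sum h1
  have s2 := sum_le_sum h2
  rw [← card_missing_right] at s1
  rw [← card_missing_left] at s2
  omega

omit [Fintype V] [DecidableEq V] in
/-- The far pairs of `z` inside `A₁` number at least `|X ∖ N(z)|·|Y ∖ N(z)| − N₁`. -/
theorem far_pairs_product_lower (D : SimpleGraph V) [DecidableRel D.Adj] {u v : V}
    (X Y : Finset V) (memX : ∀ w, w ∈ X ↔ D.Adj v w) (memY : ∀ w, w ∈ Y ↔ D.Adj u w)
    (A₁ : Finset (V × V)) (memA₁ : ∀ p, p ∈ A₁ ↔ D.Adj p.1 p.2 ∧ D.Adj v p.1 ∧ D.Adj u p.2) (z : V) :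
    (X.filter (fun x => ¬ D.Adj z x)).card * (Y.filter (fun y => ¬ D.Adj z y)).card ≤
      (A₁.filter (fun p => ¬ D.Adj p.1 z ∧ ¬ D.Adj p.2 z)).card + (missing D X Y).card := by
  set P := (X.filter (fun x => ¬ D.Adj z x)) ×ˢ (Y.filter (fun y => ¬ D.Adj z y)) with hP
  have hcard : P.card = (X.filter (fun x => ¬ D.Adj z x)).card * (Y.filter (fun y => ¬ D.Adj z y)).card := by
    rw [hP, card_product]
  have hsplit := card_filter_add_card_filter_not (s := P) (fun p => D.Adj p.1 p.2)
  have h1 : (P.filter (fun p => D.Adj p.1 p.2)).card ≤ (A₁.filter (fun p => ¬ D.Adj p.1 z ∧ ¬ D.Adj p.2 z)).card := by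
    apply card_le_card
    intro p hp
    rw [mem_filter, hP, mem_product, mem_filter, mem_filter] at hp
    rw [mem_filter, memA₁]
    exact ⟨⟨hp.2, (memX p.1).mp hp.1.1.1, (memY p.2).mp hp.1.2.1⟩, fun h => hp.1.1.2 h.symm, fun h => hp.1.2.2 h.symm⟩
  have h2 : (P.filter (fun p => ¬ D.Adj p.1 p.2)).card ≤ (missing D X Y).card := by
    apply card_le_card
    intro p hp
    rw [mem_filter, hP, mem_product, mem_filter, mem_filter] at hp
    unfold missing
    rw [mem_filter, mem_product]
    exact ⟨⟨hp.1.1.1, hp.1.2.1⟩, hp.2⟩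
  omega

omit [Fintype V] [DecidableEq V] in
/-- A neighbour of `z` on each side is a non-adjacent `X`–`Y` pair (triangle-freeness):
`|N(z) ∩ X|·|N(z) ∩ Y| ≤ N₁`. -/
theorem mul_nbrs_le_missing (D : SimpleGraph V) [DecidableRel D.Adj]
    (htri : ∀ a b c, D.Adj a b → D.Adj a c → D.Adj b c → False) (X Y : Finset V) (z : V) :
    (X.filter (fun x => D.Adj z x)).card * (Y.filter (fun y => D.Adj z y)).card ≤ (missing D X Y).card := by
  rw [← card_product]
  apply card_le_card
  intro p hp
  rw [mem_product, mem_filter, mem_filter] at hp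
  unfold missing
  rw [mem_filter, mem_product]
  exact ⟨⟨hp.1.1, hp.2.1⟩, fun h => htri z p.1 p.2 hp.1.2 hp.2.2 h⟩

omit [DecidableEq V] in
/-- An edge `z z′` whose ends have no neighbour in `Y` has all of `Y` in its deficit. -/
theorem card_le_deficit_of_no_nbr (D : SimpleGraph V) [DecidableRel D.Adj] (Y : Finset V) {z z' : V}
    (hz : ∀ y ∈ Y, ¬ D.Adj z y) (hz' : ∀ y ∈ Y, ¬ D.Adj z' y) : Y.card ≤ deficit D (z, z') := by
  unfold deficit
  apply card_le_card
  intro y hy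
  rw [mem_filter]
  exact ⟨mem_univ _, hz y hy, hz' y hy⟩

/-- **THE FIVE-CLASS SPLIT:** `2 Σ_{A₁} + 2 Σ_{A₃} + Σ_{A₅} ≤ Σ deficit`, with `A₁ ⊆ X × Y`, `A₃ ⊆ Z × (X ∪ Y)` and
`A₅ ⊆ Z × Z` the adjacent pairs. -/
theorem sum_deficit_split_five (D : SimpleGraph V) [DecidableRel D.Adj]
    (htri : ∀ a b c, D.Adj a b → D.Adj a c → D.Adj b c → False) {u v : V} (huv : D.Adj u v) :
    2 * ∑ p ∈ (adjPairsAll D).filter (fun p => D.Adj v p.1 ∧ D.Adj u p.2), deficit D p +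
      2 * ∑ p ∈ (adjPairsAll D).filter
        (fun p => (¬ D.Adj v p.1 ∧ ¬ D.Adj u p.1) ∧ (D.Adj v p.2 ∨ D.Adj u p.2)), deficit D p +
      ∑ p ∈ (adjPairsAll D).filter
        (fun p => (¬ D.Adj v p.1 ∧ ¬ D.Adj u p.1) ∧ (¬ D.Adj v p.2 ∧ ¬ D.Adj u p.2)), deficit D p ≤
      ∑ p ∈ adjPairsAll D, deficit D p := by
  have hXY : ∀ w, D.Adj v w → ¬ D.Adj u w := fun w hv hu => htri u v w huv hu hv
  have h := sum_four_filters_le (adjPairsAll D) (deficit D)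
    (fun p => D.Adj v p.1 ∧ D.Adj u p.2) (fun p => D.Adj u p.1 ∧ D.Adj v p.2)
    (fun p => ¬ D.Adj v p.1 ∧ ¬ D.Adj u p.1)
    (fun p => (D.Adj v p.1 ∨ D.Adj u p.1) ∧ (¬ D.Adj v p.2 ∧ ¬ D.Adj u p.2))
    (fun p h2 h1 => hXY p.1 h1.1 h2.1) (fun p h3 h1 => h3.1 h1.1) (fun p h3 h2 => h3.2 h2.1)
    (fun p h4 h1 => h4.2.2 h1.2) (fun p h4 h2 => h4.2.1 h2.2)
    (fun p h4 h3 => by rcases h4.1 with h | h; exact h3.1 h; exact h3.2 h)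
  have h12 := sum_deficit_filter_swap D (fun p : V × V => D.Adj u p.1 ∧ D.Adj v p.2)
    (fun p : V × V => D.Adj v p.1 ∧ D.Adj u p.2) (fun p => by simp only [Prod.fst_swap, Prod.snd_swap]; exact and_comm)
  have h34 := sum_deficit_filter_swap D
    (fun p : V × V => (D.Adj v p.1 ∨ D.Adj u p.1) ∧ (¬ D.Adj v p.2 ∧ ¬ D.Adj u p.2))
    (fun p : V × V => (¬ D.Adj v p.1 ∧ ¬ D.Adj u p.1) ∧ (D.Adj v p.2 ∨ D.Adj u p.2))
    (fun p => by simp only [Prod.fst_swap, Prod.snd_swap]; exact and_comm)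
  rw [h12, h34] at h
  -- the pairs starting in `Z` split by the side of their second coordinate
  have h3 := sum_filter_add_sum_filter_not ((adjPairsAll D).filter (fun p => ¬ D.Adj v p.1 ∧ ¬ D.Adj u p.1))
    (fun p => D.Adj v p.2 ∨ D.Adj u p.2) (deficit D)
  rw [filter_filter, filter_filter] at h3
  have e : ((adjPairsAll D).filter (fun p => (¬ D.Adj v p.1 ∧ ¬ D.Adj u p.1) ∧ ¬ (D.Adj v p.2 ∨ D.Adj u p.2))) =
      (adjPairsAll D).filter (fun p => (¬ D.Adj v p.1 ∧ ¬ D.Adj u p.1) ∧ (¬ D.Adj v p.2 ∧ ¬ D.Adj u p.2)) := by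
    apply filter_congr
    intro p _
    rw [not_or]
  rw [e] at h3
  omega

omit [Fintype V] in
/-- `Z = {z}` with `z` having no neighbour in `X`: bipartite spanning with parts `X ∪ {z}`, `Y`. -/
theorem bipartite_of_Z_singleton_noX (D : SimpleGraph V) [DecidableRel D.Adj]
    (htri : ∀ a b c, D.Adj a b → D.Adj a c → D.Adj b c → False) {u v : V}
    (X Y : Finset V) (memX : ∀ w, w ∈ X ↔ D.Adj v w) (_memY : ∀ w, w ∈ Y ↔ D.Adj u w)
    {z : V} (hclass : ∀ w, D.Adj v w ∨ D.Adj u w ∨ w = z) (hnoX : ∀ x ∈ X, ¬ D.Adj z x) :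
    ∃ A : Finset V, ∀ x y, D.Adj x y → (x ∈ A ↔ y ∉ A) := by
  have hXind : ∀ a b, D.Adj v a → D.Adj v b → ¬ D.Adj a b := fun a b ha hb hab => htri v a b ha hb hab
  have hYind : ∀ a b, D.Adj u a → D.Adj u b → ¬ D.Adj a b := fun a b ha hb hab => htri u a b ha hb hab
  refine ⟨X ∪ {z}, fun a b hab => ?_⟩
  simp only [mem_union, mem_singleton, memX]
  constructor
  · rintro (ha | rfl) hb
    · rcases hb with hb | rfl
      · exact hXind a b ha hb hab
      · exact hnoX a ((memX a).mpr ha) hab.symm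
    · rcases hb with hb | rfl
      · exact hnoX b ((memX b).mpr hb) hab
      · exact hab.ne rfl
  · intro hb
    by_contra ha
    rw [not_or] at ha hb
    rcases hclass a with h | h | h
    · exact ha.1 h
    · rcases hclass b with h' | h' | h'
      · exact hb.1 h'
      · exact hYind a b h h' hab
      · exact hb.2 h'
    · exact ha.2 h

omit [Fintype V] [DecidableEq V] in
/-- `Z = {z}` with `z` having no neighbour in `Y`: bipartite spanning with parts `X`, `Y ∪ {z}`. -/
theorem bipartite_of_Z_singleton_noY (D : SimpleGraph V) [DecidableRel D.Adj]
    (htri : ∀ a b c, D.Adj a b → D.Adj a c → D.Adj b c → False) {u v : V}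
    (X Y : Finset V) (memX : ∀ w, w ∈ X ↔ D.Adj v w) (memY : ∀ w, w ∈ Y ↔ D.Adj u w)
    {z : V} (hclass : ∀ w, D.Adj v w ∨ D.Adj u w ∨ w = z) (hnoY : ∀ y ∈ Y, ¬ D.Adj z y) :
    ∃ A : Finset V, ∀ x y, D.Adj x y → (x ∈ A ↔ y ∉ A) := by
  have hXind : ∀ a b, D.Adj v a → D.Adj v b → ¬ D.Adj a b := fun a b ha hb hab => htri v a b ha hb hab
  have hYind : ∀ a b, D.Adj u a → D.Adj u b → ¬ D.Adj a b := fun a b ha hb hab => htri u a b ha hb hab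
  refine ⟨X, fun a b hab => ?_⟩
  rw [memX, memX]
  constructor
  · intro ha hb
    exact hXind a b ha hb hab
  · intro hb
    by_contra ha
    rcases hclass a with h | h | rfl
    · exact ha h
    · rcases hclass b with h' | h' | rfl
      · exact hb h'
      · exact hYind a b h h' hab
      · exact hnoY a ((memY a).mpr h) hab.symm
    · rcases hclass b with h' | h' | rfl
      · exact hb h'
      · exact hnoY b ((memY b).mpr h') hab
      · exact hab.ne rfl

omit [Fintype V] [DecidableEq V] in
/-- A side assignment `A` (`X ⊆ A`, `Y ∩ A = ∅`, each `z` on the side opposite to its neighbours, adjacent `z`'s on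
opposite sides) is a bipartition when `V = X ∪ Y ∪ {z₁, z₂}`. -/
theorem bipartite_of_assignment (D : SimpleGraph V) [DecidableRel D.Adj]
    (htri : ∀ a b c, D.Adj a b → D.Adj a c → D.Adj b c → False) {u v : V}
    (X Y : Finset V) (memX : ∀ w, w ∈ X ↔ D.Adj v w) (memY : ∀ w, w ∈ Y ↔ D.Adj u w)
    {z₁ z₂ : V} (hclass : ∀ w, D.Adj v w ∨ D.Adj u w ∨ w = z₁ ∨ w = z₂)
    (A : Finset V) (hXA : ∀ x ∈ X, x ∈ A) (hYA : ∀ y ∈ Y, y ∉ A)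
    (h1X : (∃ x ∈ X, D.Adj z₁ x) → z₁ ∉ A) (h1Y : (∃ y ∈ Y, D.Adj z₁ y) → z₁ ∈ A)
    (h2X : (∃ x ∈ X, D.Adj z₂ x) → z₂ ∉ A) (h2Y : (∃ y ∈ Y, D.Adj z₂ y) → z₂ ∈ A)
    (h12 : D.Adj z₁ z₂ → (z₁ ∈ A ↔ z₂ ∉ A)) :
    ∀ a b, D.Adj a b → (a ∈ A ↔ b ∉ A) := by
  have hXind : ∀ a b, D.Adj v a → D.Adj v b → ¬ D.Adj a b := fun a b ha hb hab => htri v a b ha hb hab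
  have hYind : ∀ a b, D.Adj u a → D.Adj u b → ¬ D.Adj a b := fun a b ha hb hab => htri u a b ha hb hab
  intro a b hab
  rcases hclass a with ha | ha | rfl | rfl <;> rcases hclass b with hb | hb | rfl | rfl
  · exact (hXind a b ha hb hab).elim
  · exact ⟨fun _ => hYA b ((memY b).mpr hb), fun _ => hXA a ((memX a).mpr ha)⟩
  · exact ⟨fun _ => h1X ⟨a, (memX a).mpr ha, hab.symm⟩, fun _ => hXA a ((memX a).mpr ha)⟩
  · exact ⟨fun _ => h2X ⟨a, (memX a).mpr ha, hab.symm⟩, fun _ => hXA a ((memX a).mpr ha)⟩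
  · exact ⟨fun h => (hYA a ((memY a).mpr ha) h).elim, fun h => (h (hXA b ((memX b).mpr hb))).elim⟩
  · exact (hYind a b ha hb hab).elim
  · exact ⟨fun h => (hYA a ((memY a).mpr ha) h).elim, fun h => (h (h1Y ⟨a, (memY a).mpr ha, hab.symm⟩)).elim⟩
  · exact ⟨fun h => (hYA a ((memY a).mpr ha) h).elim, fun h => (h (h2Y ⟨a, (memY a).mpr ha, hab.symm⟩)).elim⟩
  · exact ⟨fun h => (h1X ⟨b, (memX b).mpr hb, hab⟩ h).elim, fun h => (h (hXA b ((memX b).mpr hb))).elim⟩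
  · exact ⟨fun _ => hYA b ((memY b).mpr hb), fun _ => h1Y ⟨b, (memY b).mpr hb, hab⟩⟩
  · exact (hab.ne rfl).elim
  · exact h12 hab
  · exact ⟨fun h => (h2X ⟨b, (memX b).mpr hb, hab⟩ h).elim, fun h => (h (hXA b ((memX b).mpr hb))).elim⟩
  · exact ⟨fun _ => hYA b ((memY b).mpr hb), fun _ => h2Y ⟨b, (memY b).mpr hb, hab⟩⟩
  · have := h12 hab.symm
    tauto
  · exact (hab.ne rfl).elim

omit [Fintype V] in
/-- `Z = {z₁, z₂}` with every `X`–`Y` pair adjacent: either the graph is bipartite spanning, or `z₁ ~ z₂` with both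
having a neighbour in `X`, or both in `Y`. -/
theorem bipartite_of_Z_pair (D : SimpleGraph V) [DecidableRel D.Adj]
    (htri : ∀ a b c, D.Adj a b → D.Adj a c → D.Adj b c → False) {u v : V} (huv : D.Adj u v)
    (X Y : Finset V) (memX : ∀ w, w ∈ X ↔ D.Adj v w) (memY : ∀ w, w ∈ Y ↔ D.Adj u w)
    {z₁ z₂ : V} (hne : z₁ ≠ z₂) (hz₁ : ¬ D.Adj v z₁ ∧ ¬ D.Adj u z₁) (hz₂ : ¬ D.Adj v z₂ ∧ ¬ D.Adj u z₂)
    (hclass : ∀ w, D.Adj v w ∨ D.Adj u w ∨ w = z₁ ∨ w = z₂)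
    (hall : ∀ x ∈ X, ∀ y ∈ Y, D.Adj x y) :
    (∃ A : Finset V, ∀ x y, D.Adj x y → (x ∈ A ↔ y ∉ A)) ∨
      (D.Adj z₁ z₂ ∧ (((∃ x ∈ X, D.Adj z₁ x) ∧ (∃ x ∈ X, D.Adj z₂ x)) ∨
        ((∃ y ∈ Y, D.Adj z₁ y) ∧ (∃ y ∈ Y, D.Adj z₂ y)))) := by
  have hXY : ∀ w, D.Adj v w → ¬ D.Adj u w := fun w hv hu => htri u v w huv hu hv
  have hone : ∀ z, (∃ x ∈ X, D.Adj z x) → (∃ y ∈ Y, D.Adj z y) → False := by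
    rintro z ⟨x, hx, hzx⟩ ⟨y, hy, hzy⟩
    exact htri z x y hzx hzy (hall x hx y hy)
  have hz₁X : z₁ ∉ X := fun h => hz₁.1 ((memX z₁).mp h)
  have hz₂X : z₂ ∉ X := fun h => hz₂.1 ((memX z₂).mp h)
  have hz₁Y : z₁ ∉ Y := fun h => hz₁.2 ((memY z₁).mp h)
  have hz₂Y : z₂ ∉ Y := fun h => hz₂.2 ((memY z₂).mp h)
  have hYX : ∀ y ∈ Y, y ∉ X := fun y hy hx => hXY y ((memX y).mp hx) ((memY y).mp hy)
  have hne' : z₂ ≠ z₁ := fun h => hne h.symm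
  -- the four assignments
  have mk := bipartite_of_assignment D htri X Y memX memY hclass
  have fX : ∀ x ∈ X, x ∈ X := fun x hx => hx
  have fX1 : ∀ x ∈ X, x ∈ X ∪ {z₁} := fun x hx => mem_union_left _ hx
  have fX2 : ∀ x ∈ X, x ∈ X ∪ {z₂} := fun x hx => mem_union_left _ hx
  have fX12 : ∀ x ∈ X, x ∈ X ∪ {z₁, z₂} := fun x hx => mem_union_left _ hx
  have gY : ∀ y ∈ Y, y ∉ X := hYX
  have gY1 : ∀ y ∈ Y, y ∉ X ∪ {z₁} := fun y hy h => by
    rw [mem_union, mem_singleton] at h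
    rcases h with h | rfl
    · exact hYX y hy h
    · exact hz₁Y hy
  have gY2 : ∀ y ∈ Y, y ∉ X ∪ {z₂} := fun y hy h => by
    rw [mem_union, mem_singleton] at h
    rcases h with h | rfl
    · exact hYX y hy h
    · exact hz₂Y hy
  have gY12 : ∀ y ∈ Y, y ∉ X ∪ {z₁, z₂} := fun y hy h => by
    rw [mem_union, mem_insert, mem_singleton] at h
    rcases h with h | rfl | rfl
    · exact hYX y hy h
    · exact hz₁Y hy
    · exact hz₂Y hy
  have m1_1 : z₁ ∈ X ∪ {z₁} := mem_union_right _ (mem_singleton_self _)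
  have m1_2 : z₁ ∉ X ∪ {z₂} := fun h => by
    rw [mem_union, mem_singleton] at h
    rcases h with h | h
    · exact hz₁X h
    · exact hne h
  have m1_12 : z₁ ∈ X ∪ {z₁, z₂} := mem_union_right _ (mem_insert_self _ _)
  have m2_1 : z₂ ∉ X ∪ {z₁} := fun h => by
    rw [mem_union, mem_singleton] at h
    rcases h with h | h
    · exact hz₂X h
    · exact hne' h
  have m2_2 : z₂ ∈ X ∪ {z₂} := mem_union_right _ (mem_singleton_self _)
  have m2_12 : z₂ ∈ X ∪ {z₁, z₂} := mem_union_right _ (mem_insert_of_mem (mem_singleton_self _))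
  by_cases h12 : D.Adj z₁ z₂
  · by_cases s1X : ∃ x ∈ X, D.Adj z₁ x <;> by_cases s2X : ∃ x ∈ X, D.Adj z₂ x
    · exact Or.inr ⟨h12, Or.inl ⟨s1X, s2X⟩⟩
    · -- `z₁` on the `Y` side, `z₂` on the `X` side
      refine Or.inl ⟨X ∪ {z₂}, mk _ fX2 gY2 (fun _ => m1_2) (fun h => (hone z₁ s1X h).elim)
        (fun h => (s2X h).elim) (fun _ => m2_2) (fun _ => ⟨fun h => (m1_2 h).elim, fun h => (h m2_2).elim⟩)⟩
    · refine Or.inl ⟨X ∪ {z₁}, mk _ fX1 gY1 (fun h => (s1X h).elim) (fun _ => m1_1)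
        (fun _ => m2_1) (fun h => (hone z₂ s2X h).elim) (fun _ => ⟨fun _ => m2_1, fun _ => m1_1⟩)⟩
    · by_cases s1Y : ∃ y ∈ Y, D.Adj z₁ y <;> by_cases s2Y : ∃ y ∈ Y, D.Adj z₂ y
      · exact Or.inr ⟨h12, Or.inr ⟨s1Y, s2Y⟩⟩
      · refine Or.inl ⟨X ∪ {z₁}, mk _ fX1 gY1 (fun h => (s1X h).elim) (fun _ => m1_1)
          (fun h => (s2X h).elim) (fun h => (s2Y h).elim) (fun _ => ⟨fun _ => m2_1, fun _ => m1_1⟩)⟩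
      · refine Or.inl ⟨X ∪ {z₂}, mk _ fX2 gY2 (fun h => (s1X h).elim) (fun h => (s1Y h).elim)
          (fun h => (s2X h).elim) (fun _ => m2_2) (fun _ => ⟨fun h => (m1_2 h).elim, fun h => (h m2_2).elim⟩)⟩
      · refine Or.inl ⟨X ∪ {z₁}, mk _ fX1 gY1 (fun h => (s1X h).elim) (fun h => (s1Y h).elim)
          (fun h => (s2X h).elim) (fun h => (s2Y h).elim) (fun _ => ⟨fun _ => m2_1, fun _ => m1_1⟩)⟩
  · -- `z₁ ≁ z₂`: each `z` on the side opposite to its neighbours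
    by_cases s1X : ∃ x ∈ X, D.Adj z₁ x <;> by_cases s2X : ∃ x ∈ X, D.Adj z₂ x
    · exact Or.inl ⟨X, mk _ fX gY (fun _ => hz₁X) (fun h => (hone z₁ s1X h).elim)
        (fun _ => hz₂X) (fun h => (hone z₂ s2X h).elim) (fun h => (h12 h).elim)⟩
    · exact Or.inl ⟨X ∪ {z₂}, mk _ fX2 gY2 (fun _ => m1_2) (fun h => (hone z₁ s1X h).elim)
        (fun h => (s2X h).elim) (fun _ => m2_2) (fun h => (h12 h).elim)⟩
    · exact Or.inl ⟨X ∪ {z₁}, mk _ fX1 gY1 (fun h => (s1X h).elim) (fun _ => m1_1)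
        (fun _ => m2_1) (fun h => (hone z₂ s2X h).elim) (fun h => (h12 h).elim)⟩
    · exact Or.inl ⟨X ∪ {z₁, z₂}, mk _ fX12 gY12 (fun h => (s1X h).elim) (fun _ => m1_12)
        (fun h => (s2X h).elim) (fun _ => m2_12) (fun h => (h12 h).elim)⟩

end C047

end TriangleCap

end PercRepro
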